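import Summits.CriticalPhenomena.SAWScalingLimit.Theorems.SAWRenewalTightnessAnnularMassDecayLastRenewalDefs
import Literature.Probability.RandomPlanarGeometry.UniformSAWCurveLaw

/-!
# Crux `SAWRenewalTightness.AnnularMassDecay` (stmt-CriticalPhenomena-4729), line `last-renewal-delocalization`:
# S2a `stub_straddleBlocks` — the straddling family packaged as blocks

For a real direction `e ∈ ℂ`, a start `u`, a level `ℓ`, a finite set of offsets `S` and truncations `N, N'`, the
nested straddling sum of S2,
`Σ_{y ∈ S, h(y) < ℓ} (Σ_{m ≤ N} Σ_{β : e-bridge u → u + y} x^m) · (Σ_{m' ≤ N'} Σ_{γ irreducible, span ≥ ℓ - h(y)} x^{m'})`,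
is, for every real fugacity `x`, the generating polynomial `Σ_{b ∈ B} x^{n_b}` of a finite set `B` of BLOCKS
`b = (n, w)`: `n`-step self-avoiding `e`-bridges from `0` with `1 ≤ n ≤ N + N'`, end height `≥ ℓ`, and the MARKER
property — every `e`-renewal time `s ∈ [1, n-1]` of `w` has height `< ℓ` (registered stub `stub_straddleBlocks` of
the checked skeleton of the line; vocabulary `ht`, `IsBr`, `IsRen`, `IsIrr` from `…AnnularMassDecayLastRenewalDefs`).

Proof.  `B` is the image of the finite index set `W = {(y, (m, β), (m', γ))}` of the nested sum under
`(y, (m, β), (m', γ)) ↦ (m + m', β ⊕ γ)` (`SAW.Zd.concatWalk`).  Heights add along a concatenation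
(`lsb_ht_concat_add`), the bridge `β` lies weakly below its end `β m = y` (height `h(y) ≥ 0`) and `γ` strictly above
its start, so `β ⊕ γ` is self-avoiding (`SAW.Zd.concatWalk_mem_saws`), an `e`-bridge from `0` of end height
`h(y) + h(γ_{m'}) ≥ ℓ`, the time `m` is a renewal time of `β ⊕ γ` (`lsb_isRen_mid`) and a renewal time `s > m` of
`β ⊕ γ` restricts to the renewal time `s - m` of `γ` (`lsb_isRen_tail`), which irreducibility forbids in
`[1, m'-1]`: this gives the marker property (`lsb_block`) and the injectivity of `W → B` (`lsb_inj`: if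
`β ⊕ γ = β₂ ⊕ γ₂` with `m < m₂` then `m₂ - m ∈ [1, m'-1]` would be a renewal time of `γ`; so `m = m₂` and
`SAW.Zd.headPart_concatWalk` / `SAW.Zd.tailPart_concatWalk` recover the pieces).  The sum identity is then
`Finset.sum_sigma` / `Finset.sum_mul_sum`-bookkeeping, `pow_add` and `Finset.sum_image` (`lsb_index_set`,
`lsb_abstract_packaging`).  This is the family "bridge irreducible above height `ℓ`" of
Dyhr–Gilbert–Kennedy–Lawler–Passon, J. Stat. Phys. 144 (2011), arXiv:1008.4321 §2, written with Kesten's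
irreducible bridges (H. Kesten, J. Math. Phys. 4 (1963) §4; N. Madras, G. Slade, *The Self-Avoiding Walk* (1993)
§1.2, §4.2).
-/

noncomputable section

namespace Summit.CriticalPhenomena.SAWScalingLimit.Theorems.AnnularMassDecay.LastRenewal

open scoped BigOperators Classical ComplexConjugate
open Literature.Probability.LatticeModels Literature.Probability.RandomPlanarGeometry

/-! ## Positions and heights of a concatenation -/

/-- Up to time `m` the concatenation `β ⊕ γ` is `β`. [folklore] -/
theorem lsb_concat_of_le {m i : ℕ} (β γ : ℕ → Site 2) (hi : i ≤ m) :
    SAW.Zd.concatWalk m β γ i = β i := if_pos hi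

/-- After time `m` the concatenation `β ⊕ γ` is the translate of `γ` by `β m` (also at time `m`, as `γ 0 = 0`).
[folklore] -/
theorem lsb_concat_add {m : ℕ} (β : ℕ → Site 2) {γ : ℕ → Site 2} (hγ0 : γ 0 = 0) (i : ℕ) :
    SAW.Zd.concatWalk m β γ (m + i) = β m + γ i := by
  rcases Nat.eq_zero_or_pos i with rfl | hi
  · rw [add_zero, hγ0, add_zero]
    exact if_pos le_rfl
  · show (if m + i ≤ m then β (m + i) else β m + γ (m + i - m)) = β m + γ i
    rw [if_neg (by omega), Nat.add_sub_cancel_left]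

/-- Heights add along a concatenation: `h((β ⊕ γ)_{m+i}) = h(β_m) + h(γ_i)`. [folklore] -/
theorem lsb_ht_concat_add (e : ℂ) {m : ℕ} (β : ℕ → Site 2) {γ : ℕ → Site 2} (hγ0 : γ 0 = 0) (i : ℕ) :
    ht e 0 (SAW.Zd.concatWalk m β γ (m + i)) = ht e 0 (β m) + ht e 0 (γ i) := by
  rw [lsb_concat_add β hγ0, ht_zero_add]

/-- `IsBr` at the base point `0`, with the junk translate `0 + ·` removed. [folklore] -/
theorem lsb_isBr_zero_iff (e : ℂ) (m : ℕ) (β : ℕ → Site 2) :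
    IsBr e 0 m β ↔ (∀ i, 1 ≤ i → i ≤ m → 0 < ht e 0 (β i)) ∧ (∀ i, i ≤ m → ht e 0 (β i) ≤ ht e 0 (β m)) := by
  simp only [IsBr, zero_add]

/-- The end of an `e`-bridge from `0` has nonnegative height (the start has height `0`). [folklore] -/
theorem lsb_end_nonneg {e : ℂ} {m : ℕ} {β : ℕ → Site 2} (hβ : IsBr e 0 m β) (hβ0 : β 0 = 0) :
    0 ≤ ht e 0 (β m) := by
  have h := ((lsb_isBr_zero_iff e m β).1 hβ).2 0 (Nat.zero_le m)
  rwa [hβ0, ht_self] at h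

/-! ## Renewal times of a concatenation -/

/-- A renewal time `s ≥ m` of `β ⊕ γ` (run up to time `m + m'`) restricts to the renewal time `s - m` of `γ`
(run up to time `m'`): the past of `γ` is part of the past of `β ⊕ γ`, the futures coincide, and heights are
translated by `h(β_m)`. [cite: DyhrGilbertKennedyLawlerPasson2011, §2] -/
theorem lsb_isRen_tail {e : ℂ} {m m' s : ℕ} {β γ : ℕ → Site 2} (hγ0 : γ 0 = 0) (hms : m ≤ s)
    (h : IsRen e 0 (SAW.Zd.concatWalk m β γ) (m + m') s) :
    IsRen e 0 (fun i => (0 : Site 2) + γ i) m' (s - m) := by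
  rw [isRen_translate]
  obtain ⟨k, rfl⟩ : ∃ k, s = m + k := ⟨s - m, by omega⟩
  rw [Nat.add_sub_cancel_left]
  obtain ⟨hp, hf⟩ := h
  refine ⟨fun i hi => ?_, fun j hj hjm => ?_⟩
  · have h1 := hp (m + i) (by omega)
    rwa [lsb_ht_concat_add e β hγ0, lsb_ht_concat_add e β hγ0, add_le_add_iff_left] at h1
  · have h1 := hf (m + j) (by omega) (by omega)
    rwa [lsb_ht_concat_add e β hγ0, lsb_ht_concat_add e β hγ0, add_lt_add_iff_left] at h1

/-- The junction time `m` of `β ⊕ γ` (two `e`-bridges from `0`) is a renewal time: the bridge `β` lies weakly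
below its end, and `γ` strictly above its start after time `0`. [cite: MadrasSlade1993, §1.2, eq. (1.2.15)] -/
theorem lsb_isRen_mid {e : ℂ} {m m' : ℕ} {β γ : ℕ → Site 2} (hβ : IsBr e 0 m β) (hγ : IsBr e 0 m' γ)
    (hγ0 : γ 0 = 0) : IsRen e 0 (SAW.Zd.concatWalk m β γ) (m + m') m := by
  rw [lsb_isBr_zero_iff] at hβ hγ
  refine ⟨fun i hi => ?_, fun j hj hjn => ?_⟩
  · rw [lsb_concat_of_le β γ hi.le, lsb_concat_of_le β γ le_rfl]
    exact hβ.2 i hi.le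
  · obtain ⟨k, rfl⟩ : ∃ k, j = m + k := ⟨j - m, by omega⟩
    rw [lsb_concat_of_le β γ le_rfl, lsb_ht_concat_add e β hγ0]
    have h1 := hγ.1 k (by omega) (by omega)
    linarith

/-! ## Injectivity of `(β, γ) ↦ β ⊕ γ` on (bridge, irreducible bridge) pairs -/

/-- If `β ⊕ γ = β₂ ⊕ γ₂` have the same length, `γ, γ₂` irreducible and `β₂` a bridge, then the junction of the
second decomposition is not later than that of the first: otherwise `m₂` (a renewal time of the common walk)
would restrict to a renewal time of `γ` in `[1, m'-1]`. [cite: Kesten1963SAW, §4] -/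
theorem lsb_not_lt {e : ℂ} {m m' m₂ m₂' : ℕ} {β γ β₂ γ₂ : ℕ → Site 2}
    (hγ : IsIrr e m' γ) (hγ0 : γ 0 = 0) (hβ₂ : IsBr e 0 m₂ β₂) (hγ₂ : IsIrr e m₂' γ₂) (hγ₂0 : γ₂ 0 = 0)
    (hn : m + m' = m₂ + m₂') (hw : SAW.Zd.concatWalk m β γ = SAW.Zd.concatWalk m₂ β₂ γ₂) :
    ¬ m < m₂ := by
  intro hlt
  have hren := lsb_isRen_mid hβ₂ hγ₂.2.1 hγ₂0
  rw [← hw, ← hn] at hren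
  have h1 := hγ₂.1
  exact hγ.2.2 (m₂ - m) (by omega) (by omega) (lsb_isRen_tail hγ0 hlt.le hren)

/-- **Unique decoding of `β ⊕ γ`** (`β` a bridge, `γ` an irreducible bridge, all self-avoiding): the total length
and the concatenated walk determine `m`, `m'`, `β` and `γ`. [cite: Kesten1963SAW, §4] -/
theorem lsb_inj {e : ℂ} {m m' m₂ m₂' : ℕ} {β γ β₂ γ₂ : ℕ → Site 2}
    (hβs : β ∈ SAW.Zd.saws 2 m) (hγs : γ ∈ SAW.Zd.saws 2 m') (hβ : IsBr e 0 m β) (hγ : IsIrr e m' γ)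
    (hβ₂s : β₂ ∈ SAW.Zd.saws 2 m₂) (hγ₂s : γ₂ ∈ SAW.Zd.saws 2 m₂') (hβ₂ : IsBr e 0 m₂ β₂)
    (hγ₂ : IsIrr e m₂' γ₂) (hn : m + m' = m₂ + m₂')
    (hw : SAW.Zd.concatWalk m β γ = SAW.Zd.concatWalk m₂ β₂ γ₂) :
    m = m₂ ∧ m' = m₂' ∧ β = β₂ ∧ γ = γ₂ := by
  have hγ0 : γ 0 = 0 := (SAW.Zd.mem_saws.1 hγs).1
  have hγ₂0 : γ₂ 0 = 0 := (SAW.Zd.mem_saws.1 hγ₂s).1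
  have h1 := lsb_not_lt hγ hγ0 hβ₂ hγ₂ hγ₂0 hn hw
  have h2 := lsb_not_lt hγ₂ hγ₂0 hβ hγ hγ0 hn.symm hw.symm
  obtain rfl : m = m₂ := by omega
  obtain rfl : m' = m₂' := by omega
  refine ⟨rfl, rfl, ?_, ?_⟩
  · rw [← SAW.Zd.headPart_concatWalk hβs γ, hw, SAW.Zd.headPart_concatWalk hβ₂s]
  · rw [← SAW.Zd.tailPart_concatWalk (m := m) β hγs, hw, SAW.Zd.tailPart_concatWalk β₂ hγ₂s]

/-! ## The blocks `β ⊕ γ` -/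

/-- **The block `β ⊕ γ`.**  For a self-avoiding `e`-bridge `β` from `0` with end height `h(β_m) < ℓ` and an
irreducible self-avoiding `e`-bridge `γ` of span `≥ ℓ - h(β_m)`: `β ⊕ γ` has length `m + m' ≥ 1`, is self-avoiding
(the pieces are separated by height), is an `e`-bridge from `0` with end height `≥ ℓ`, and each of its renewal
times in `[1, m + m' - 1]` has height `< ℓ` (those `≤ m` lie weakly below `β_m`; one `> m` would be a renewal time
of `γ` in `[1, m'-1]`). [cite: DyhrGilbertKennedyLawlerPasson2011, §2] -/
theorem lsb_block {e : ℂ} {ℓ : ℝ} {m m' : ℕ} {β γ : ℕ → Site 2}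
    (hβs : β ∈ SAW.Zd.saws 2 m) (hγs : γ ∈ SAW.Zd.saws 2 m') (hβ : IsBr e 0 m β) (hγ : IsIrr e m' γ)
    (hyl : ht e 0 (β m) < ℓ) (hsp : ℓ - ht e 0 (β m) ≤ ht e 0 (γ m')) :
    1 ≤ m + m' ∧ SAW.Zd.concatWalk m β γ ∈ SAW.Zd.saws 2 (m + m') ∧
      IsBr e 0 (m + m') (SAW.Zd.concatWalk m β γ) ∧
      ℓ ≤ ht e 0 (SAW.Zd.concatWalk m β γ (m + m')) ∧
      ∀ s, 1 ≤ s → s < m + m' → IsRen e 0 (SAW.Zd.concatWalk m β γ) (m + m') s →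
        ht e 0 (SAW.Zd.concatWalk m β γ s) < ℓ := by
  have hγ0 : γ 0 = 0 := (SAW.Zd.mem_saws.1 hγs).1
  obtain ⟨hm', hγb, hγirr⟩ := hγ
  have hβ' := (lsb_isBr_zero_iff e m β).1 hβ
  have hγ' := (lsb_isBr_zero_iff e m' γ).1 hγb
  have hγend : 0 ≤ ht e 0 (γ m') := lsb_end_nonneg hγb hγ0
  -- heights of the `β`-part are `≤ h(β m)`, heights of the `γ`-part are `> h(β m)`
  have hlow : ∀ i, i ≤ m → ht e 0 (SAW.Zd.concatWalk m β γ i) ≤ ht e 0 (β m) := fun i hi => by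
    rw [lsb_concat_of_le β γ hi]
    exact hβ'.2 i hi
  have hhigh : ∀ k, 1 ≤ k → k ≤ m' → ht e 0 (β m) < ht e 0 (SAW.Zd.concatWalk m β γ (m + k)) := fun k hk hkm => by
    rw [lsb_ht_concat_add e β hγ0]
    have h1 := hγ'.1 k hk hkm
    linarith
  have hend : ht e 0 (SAW.Zd.concatWalk m β γ (m + m')) = ht e 0 (β m) + ht e 0 (γ m') :=
    lsb_ht_concat_add e β hγ0 m'
  refine ⟨by omega, ?_, ?_, ?_, ?_⟩
  · -- self-avoiding: the pieces are separated by height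
    refine SAW.Zd.concatWalk_mem_saws hβs hγs fun i hi j hj hjm h => ?_
    have h1 := hβ'.2 i hi
    have h2 := hγ'.1 j hj hjm
    rw [h, ht_zero_add] at h1
    linarith
  · -- an `e`-bridge from `0`
    rw [lsb_isBr_zero_iff]
    refine ⟨fun i hi hin => ?_, fun i hin => ?_⟩
    · rcases le_or_gt i m with him | him
      · rw [lsb_concat_of_le β γ him]
        exact hβ'.1 i hi him
      · obtain ⟨k, rfl⟩ : ∃ k, i = m + k := ⟨i - m, by omega⟩
        have h1 := hhigh k (by omega) (by omega)
        have h2 := lsb_end_nonneg hβ (SAW.Zd.mem_saws.1 hβs).1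
        linarith
    · rw [hend]
      rcases le_or_gt i m with him | him
      · have h1 := hlow i him
        linarith
      · obtain ⟨k, rfl⟩ : ∃ k, i = m + k := ⟨i - m, by omega⟩
        rw [lsb_ht_concat_add e β hγ0, add_le_add_iff_left]
        exact hγ'.2 k (by omega)
  · -- end height `≥ ℓ`
    rw [hend]
    linarith
  · -- the marker property
    intro s hs1 hs2 hren
    rcases le_or_gt s m with hsm | hsm
    · exact (hlow s hsm).trans_lt hyl
    · exact absurd (lsb_isRen_tail hγ0 hsm.le hren) (hγirr (s - m) (by omega) (by omega))

/-! ## Finite-sum bookkeeping -/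

/-- The index set of a nested sum `Σ_{y ∈ X} (Σ_{m ≤ N} Σ_{β ∈ S m, P y m β} x^m)(Σ_{k ≤ N'} Σ_{γ ∈ S k, Q y k γ} x^k)`
as ONE finite set of triples `(y, (m, β), (k, γ))`, with the product expanded (`Finset.sum_sigma`,
`Finset.sum_mul`, `Finset.mul_sum`). [folklore] -/
theorem lsb_index_set {ι α : Type*} (X : Finset ι) (N N' : ℕ) (S : ℕ → Finset α)
    (P Q : ι → ℕ → α → Prop) {instP : ∀ y m, DecidablePred (P y m)} {instQ : ∀ y k, DecidablePred (Q y k)} :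
    ∃ W : Finset (Σ _ : ι, Σ _ : (Σ _ : ℕ, α), (Σ _ : ℕ, α)),
      (∀ w ∈ W, w.1 ∈ X ∧ (w.2.1.1 ≤ N ∧ w.2.1.2 ∈ S w.2.1.1 ∧ P w.1 w.2.1.1 w.2.1.2) ∧
        (w.2.2.1 ≤ N' ∧ w.2.2.2 ∈ S w.2.2.1 ∧ Q w.1 w.2.2.1 w.2.2.2)) ∧
      ∀ x : ℝ, ∑ y ∈ X, (∑ m ∈ Finset.range (N + 1), ∑ _β ∈ (S m).filter (P y m), x ^ m) *
          (∑ k ∈ Finset.range (N' + 1), ∑ _γ ∈ (S k).filter (Q y k), x ^ k) =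
        ∑ w ∈ W, x ^ w.2.1.1 * x ^ w.2.2.1 := by
  refine ⟨X.sigma (fun y => ((Finset.range (N + 1)).sigma (fun m => (S m).filter (P y m))).sigma
      (fun _ => (Finset.range (N' + 1)).sigma (fun k => (S k).filter (Q y k)))), fun w hw => ?_, fun x => ?_⟩
  · simp only [Finset.mem_sigma, Finset.mem_filter, Finset.mem_range] at hw
    obtain ⟨hy, ⟨hm, hβ, hP⟩, hk, hγ, hQ⟩ := hw
    exact ⟨hy, ⟨Nat.le_of_lt_succ hm, hβ, hP⟩, Nat.le_of_lt_succ hk, hγ, hQ⟩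
  · rw [Finset.sum_sigma]
    refine Finset.sum_congr rfl fun y _ => ?_
    rw [Finset.sum_sigma, Finset.sum_sigma, Finset.sum_mul]
    refine Finset.sum_congr rfl fun m _ => ?_
    rw [Finset.sum_mul]
    refine Finset.sum_congr rfl fun β _ => ?_
    rw [Finset.mul_sum, Finset.sum_sigma]
    refine Finset.sum_congr rfl fun k _ => ?_
    rw [Finset.mul_sum]

/-- **Abstract packaging.**  If a map `Φ (m, β) (k, γ)` of "length" `m + k` sends every index of the nested sum to
a `good` object and is injective on the index set (the index `y` included), then the nested sum is, at every real
fugacity, the generating polynomial `Σ_{b ∈ B} x^{len b}` of a finite set `B` of good objects (the image;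
`Finset.sum_image`, `pow_add`). [folklore] -/
theorem lsb_abstract_packaging {ι α δ : Type*} [DecidableEq δ] (X : Finset ι) (N N' : ℕ)
    (S : ℕ → Finset α) (P Q : ι → ℕ → α → Prop)
    {instP : ∀ y m, DecidablePred (P y m)} {instQ : ∀ y k, DecidablePred (Q y k)}
    (good : δ → Prop) (len : δ → ℕ) (Φ : ℕ → α → ℕ → α → δ)
    (hlen : ∀ m β k γ, len (Φ m β k γ) = m + k)
    (hgood : ∀ y ∈ X, ∀ m β k γ, m ≤ N → β ∈ S m → P y m β → k ≤ N' → γ ∈ S k → Q y k γ →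
      good (Φ m β k γ))
    (hinj : ∀ y ∈ X, ∀ y' ∈ X, ∀ m β k γ m' β' k' γ', β ∈ S m → P y m β → γ ∈ S k → Q y k γ →
      β' ∈ S m' → P y' m' β' → γ' ∈ S k' → Q y' k' γ' → Φ m β k γ = Φ m' β' k' γ' →
      y = y' ∧ m = m' ∧ β = β' ∧ k = k' ∧ γ = γ') :
    ∃ B : Finset δ, (∀ b ∈ B, good b) ∧ ∀ x : ℝ,
      ∑ y ∈ X, (∑ m ∈ Finset.range (N + 1), ∑ _β ∈ (S m).filter (P y m), x ^ m) *
        (∑ k ∈ Finset.range (N' + 1), ∑ _γ ∈ (S k).filter (Q y k), x ^ k) = ∑ b ∈ B, x ^ len b := by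
  obtain ⟨W, hmem, hsum⟩ := lsb_index_set X N N' S P Q (instP := instP) (instQ := instQ)
  have hinjW : Set.InjOn (fun w : (Σ _ : ι, Σ _ : (Σ _ : ℕ, α), (Σ _ : ℕ, α)) =>
      Φ w.2.1.1 w.2.1.2 w.2.2.1 w.2.2.2) W := by
    rintro ⟨y, ⟨m, β⟩, ⟨k, γ⟩⟩ hw ⟨y', ⟨m', β'⟩, ⟨k', γ'⟩⟩ hw' h
    obtain ⟨hy, ⟨-, hβ, hP⟩, -, hγ, hQ⟩ := hmem _ (Finset.mem_coe.1 hw)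
    obtain ⟨hy', ⟨-, hβ', hP'⟩, -, hγ', hQ'⟩ := hmem _ (Finset.mem_coe.1 hw')
    obtain ⟨rfl, rfl, rfl, rfl, rfl⟩ :=
      hinj y hy y' hy' m β k γ m' β' k' γ' hβ hP hγ hQ hβ' hP' hγ' hQ' h
    rfl
  refine ⟨W.image fun w => Φ w.2.1.1 w.2.1.2 w.2.2.1 w.2.2.2, fun b hb => ?_, fun x => ?_⟩
  · obtain ⟨w, hw, rfl⟩ := Finset.mem_image.1 hb
    obtain ⟨hy, ⟨hm, hβ, hP⟩, hk, hγ, hQ⟩ := hmem w hw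
    exact hgood _ hy _ _ _ _ hm hβ hP hk hγ hQ
  · rw [hsum x, Finset.sum_image hinjW]
    exact Finset.sum_congr rfl fun w _ => by rw [hlen, pow_add]

/-! ## The stub -/

/-- **S2a · `stub_straddleBlocks`** — THE STRADDLING FAMILY AS BLOCKS.  For every `e`, start `u`, level `ℓ`, finite
`S` and `N, N'` there is a finite set `B` of blocks `(n, w)` such that (i) every block is an `n`-step self-avoiding
`e`-bridge from `0` with `1 ≤ n ≤ N + N'`, end height `≥ ℓ`, and every renewal time `s ∈ [1, n-1]` at height
`< ℓ`; (ii) for every real `x`, `Σ_{b ∈ B} x^{n_b}` equals the nested straddling sum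
`Σ_{y ∈ S, h(y) < ℓ} (Σ_{m ≤ N} Σ_{β bridge u → u+y} x^m)(Σ_{m ≤ N'} Σ_{γ irreducible, span ≥ ℓ - h(y)} x^m)`.
`B` is the image of the index set under `(y, (m, β), (m', γ)) ↦ (m + m', β ⊕ γ)`; the blocks are good by
`lsb_block` (heights only see offsets: `ht_base_add`, `isBr_iff_zero`), the map is injective by `lsb_inj`, and
the sums agree by `lsb_abstract_packaging`. [cite: DyhrGilbertKennedyLawlerPasson2011, §2] -/
theorem stub_straddleBlocks :
    ∀ (e : ℂ) (u : Site 2) (ℓ : ℝ) (S : Finset (Site 2)) (N N' : ℕ),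
      ∃ B : Finset (ℕ × (ℕ → Site 2)),
        (∀ b ∈ B, 1 ≤ b.1 ∧ b.1 ≤ N + N' ∧ b.2 ∈ SAW.Zd.saws 2 b.1 ∧ IsBr e 0 b.1 b.2 ∧ ℓ ≤ ht e 0 (b.2 b.1) ∧
            ∀ s, 1 ≤ s → s < b.1 → IsRen e 0 b.2 b.1 s → ht e 0 (b.2 s) < ℓ) ∧
        ∀ x : ℝ,
          ∑ y ∈ S.filter (fun y => ht e u (u + y) < ℓ),
            (∑ m ∈ Finset.range (N + 1),
                ∑ _β ∈ (SAW.Zd.saws 2 m).filter (fun β => IsBr e u m β ∧ β m = y), x ^ m) *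
            (∑ m ∈ Finset.range (N' + 1),
                ∑ _γ ∈ (SAW.Zd.saws 2 m).filter (fun γ => IsIrr e m γ ∧ ℓ - ht e u (u + y) ≤ ht e 0 (γ m)), x ^ m)
          = ∑ b ∈ B, x ^ b.1 := by
  intro e u ℓ S N N'
  refine lsb_abstract_packaging (S.filter fun y => ht e u (u + y) < ℓ) N N' (SAW.Zd.saws 2)
    (fun y m β => IsBr e u m β ∧ β m = y) (fun y m γ => IsIrr e m γ ∧ ℓ - ht e u (u + y) ≤ ht e 0 (γ m))
    (fun b : ℕ × (ℕ → Site 2) => 1 ≤ b.1 ∧ b.1 ≤ N + N' ∧ b.2 ∈ SAW.Zd.saws 2 b.1 ∧ IsBr e 0 b.1 b.2 ∧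
      ℓ ≤ ht e 0 (b.2 b.1) ∧ ∀ s, 1 ≤ s → s < b.1 → IsRen e 0 b.2 b.1 s → ht e 0 (b.2 s) < ℓ)
    Prod.fst (fun m β k γ => (m + k, SAW.Zd.concatWalk m β γ)) (fun _ _ _ _ => rfl) ?_ ?_
  · -- every block is good
    intro y hy m β k γ hm hβs hP hk hγs hQ
    obtain ⟨hβ, rfl⟩ := hP
    obtain ⟨hγ, hsp⟩ := hQ
    rw [Finset.mem_filter, ht_base_add] at hy
    rw [ht_base_add] at hsp
    rw [isBr_iff_zero] at hβ
    obtain ⟨h1, hsaw, hbr, hend, hmark⟩ := lsb_block hβs hγs hβ hγ hy.2 hsp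
    exact ⟨h1, by omega, hsaw, hbr, hend, hmark⟩
  · -- the packaging map is injective
    intro y _ y' _ m β k γ m' β' k' γ' hβs hP hγs hQ hβ's hP' hγ's hQ' h
    simp only [Prod.mk.injEq] at h
    obtain ⟨hn, hw⟩ := h
    obtain ⟨rfl, rfl, rfl, rfl⟩ := lsb_inj hβs hγs ((isBr_iff_zero e u m β).1 hP.1) hQ.1 hβ's hγ's
      ((isBr_iff_zero e u m' β').1 hP'.1) hQ'.1 hn hw
    exact ⟨hP.2.symm.trans hP'.2, rfl, rfl, rfl, rfl⟩

end Summit.CriticalPhenomena.SAWScalingLimit.Theorems.AnnularMassDecay.LastRenewal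

end
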